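import Literature.Probability.RandomPlanarGeometry.LoewnerLoopMassBounds
import HarnessLib

/-!
# The loop mass collected by a growing Loewner hull: `Λ(A, K_t; ℍ) = 2 ∫₀ᵗ m(A_s − W_s) ds`

The deterministic form of the loop-mass identity of G. F. Lawler, *Partition functions, loop
measure, and versions of SLE*, J. Stat. Phys. **134** (2009) (**[Lawler2009]**), §2.2 (display
before (4)): "`Λ(γ_t, ℍ ∖ D; ℍ) = −(a/6) ∫₀ᵗ SΦ_s(U_s) ds` … If we had chosen the parametrization
as in (1), the `a` would be replaced with `2`", i.e., in the half-plane-capacity parametrisation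
and with `m(B) = −SΦ_B(0)/6` (`starBubbleMass`), `Λ(A, K_t; ℍ) = 2 ∫₀ᵗ m(A_s − W_s) ds` for a
nonempty `A ∈ 𝒬*` alive up to time `t`. PROVED here from the analytic inputs of the printed proof
(Lawler–Werner (2004), Thm. 12; Lawler (2005), Prop. 5.34), taken as hypotheses:
`hX : loopMass_conformalImage` (conformal invariance of `Λ`, the named fact of
`BrownianLoopMeasure`, Lawler–Werner Prop. 6) and Lawler's Prop. 5.30 in the two forms `h530a`,
`h530b` of `LoewnerLoopMassBounds`.

* **`loopMass_hull_drvK_eq_lintegral`** — for the driver `W = drvK κ υ = √κ (υ − υ 0)` of a path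
  `υ`, a nonempty `A ∈ 𝒬*` alive at `T` and `t ≤ T`:
  `Λ(A, K_t; ℍ) = 2 ∫⁻_{(0,t]} MFnK κ A s υ ds` (the compensator integrand
  `MFnK = m(A_s − W_s)` of `SLERestrictionCompensatorKappa`), by `eq_of_has_deriv_right_eq`: both
  sides vanish at `0`, are continuous on `[0, T]` (the left by the uniform linear bound), and have
  right derivative `2 m(A_s − W_s)` on `[0, T)` (increment identity and `h530b`; the fundamental
  theorem of calculus at a right-continuity point of the integrand, `continuousWithinAt_MFnK`).

No definition and no named fact is introduced.

## References

* [Lawler2009] §2.2 (display before (4)).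
* G. F. Lawler, *Conformally Invariant Processes in the Plane* (2005), Prop. 5.22, Prop. 5.27,
  Prop. 5.30, Prop. 5.34. [Lawler2005]
* G. F. Lawler, W. Werner, PTRF 128 (2004), Prop. 6, Thm. 12. [LawlerWerner2004]
-/

noncomputable section

open Set Filter Topology MeasureTheory Metric
open UpperHalfPlane (upperHalfPlaneSet isOpen_upperHalfPlaneSet)
open scoped NNReal ENNReal

namespace Literature.Probability.RandomPlanarGeometry

open Loewner Literature.Probability.Process

/-! ### The identity `Λ(A, K_t; ℍ) = 2 ∫₀ᵗ m(A_s − W_s) ds` up to an alive time -/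

section Identity

variable {κ : ℝ≥0} {A : Set ℂ}

/-- **The loop-mass identity along a Loewner chain** ([Lawler2009] §2.2, display before (4), in
the parametrisation (1): `Λ(A, K_t; ℍ) = −(1/3) ∫₀ᵗ SΦ_s(W_s) ds = 2 ∫₀ᵗ m(A_s − W_s) ds`). For the
driver `W = √κ (υ − υ 0)` of a path `υ`, a nonempty `A ∈ 𝒬*` alive at time `T` and `t ≤ T`,
`Λ(A, K_t; ℍ) = 2 ∫_{(0,t]} MFnK κ A s υ ds` (`MFnK = m(A_s − W_s)` at alive times), GIVEN the
conformal invariance of `Λ` (`hX`, Lawler–Werner 2004 Prop. 6) and Lawler's Prop. 5.30 on Loewner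
hulls (`h530a`: total mass `1/r²` of the loops reaching `{|z| ≥ r}`; `h530b`: mass `m(B)` of the
loops hitting `B ∈ 𝒬*`, Prop. 5.22). Proof: both sides vanish at `t = 0`, are continuous on
`[0, T]` (the left side by the uniform linear bound `exists_loopMass_hull_incr_le`), and have the
same right derivative `2 m(A_t − W_t)` on `[0, T)` (increment identity
`loopMass_hull_add_eq_of_conformalImage` with `tendsto_loopMass_hull_incr_div`; fundamental theorem
of calculus at a right-continuity point of the integrand, `continuousWithinAt_MFnK`), so they agree
(`eq_of_has_deriv_right_eq`). [cite: Lawler2009, §2.2 (display before (4))] -/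
theorem loopMass_hull_drvK_eq_lintegral (hX : loopMass_conformalImage)
    (h530a : ∀ (U : ℕ → ℝ≥0 → ℝ) (u : ℕ → ℝ≥0), (∀ n, Continuous (U n)) → (∀ n, U n 0 = 0) →
      (∀ n, 0 < u n) → Tendsto u atTop (𝓝 0) →
      (∀ ε : ℝ, 0 < ε → ∀ᶠ n in atTop, hull (U n) (u n) ⊆ ball (0 : ℂ) ε) →
      ∀ {r : ℝ}, 0 < r →
        Tendsto (fun n ↦ (loopMass upperHalfPlaneSet (hull (U n) (u n)) {z : ℂ | r ≤ ‖z‖}).toReal /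
          (2 * (u n : ℝ))) atTop (𝓝 (1 / r ^ 2)))
    (h530b : ∀ (U : ℕ → ℝ≥0 → ℝ) (u : ℕ → ℝ≥0), (∀ n, Continuous (U n)) → (∀ n, U n 0 = 0) →
      (∀ n, 0 < u n) → Tendsto u atTop (𝓝 0) →
      (∀ ε : ℝ, 0 < ε → ∀ᶠ n in atTop, hull (U n) (u n) ⊆ ball (0 : ℂ) ε) →
      ∀ {B : Set ℂ}, IsStarHull B →
        Tendsto (fun n ↦ (loopMass upperHalfPlaneSet (hull (U n) (u n)) B).toReal / (2 * (u n : ℝ)))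
          atTop (𝓝 (starBubbleMass B)))
    (υ : C(ℝ≥0, ℝ)) (hA : IsStarHull A) (hne : A.Nonempty) {T : ℝ≥0}
    (halive : Disjoint (closedHull (drvK κ υ) T) A) {t : ℝ≥0} (ht : t ≤ T) :
    loopMass upperHalfPlaneSet A (hull (drvK κ υ) t) =
      2 * ∫⁻ s in Ioc (0 : ℝ) t, ENNReal.ofReal (MFnK κ A s.toNNReal υ) := by
  have hW : Continuous (drvK κ υ) := continuous_drvK κ υ
  have hal : ∀ s ≤ T, Disjoint (closedHull (drvK κ υ) s) A := fun s hs ↦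
    halive.mono_left (closedHull_mono _ hs)
  have halr : ∀ x : ℝ, x ≤ T → Disjoint (closedHull (drvK κ υ) x.toNNReal) A := fun x hx ↦
    hal _ (Real.toNNReal_le_iff_le_coe.2 hx)
  have hAH : A ⊆ closure upperHalfPlaneSet := hA.isBoundedHull.subset_closure
  -- the functions of a real variable
  set F : ℝ → ℝ≥0∞ := fun x ↦ loopMass upperHalfPlaneSet A (hull (drvK κ υ) x.toNNReal) with hF
  set f : ℝ → ℝ := fun x ↦ (F x).toReal with hf
  set Δ : ℝ≥0 → ℝ≥0 → ℝ≥0∞ := fun s u ↦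
    loopMass upperHalfPlaneSet (hull (fun v ↦ drvK κ υ (s + v) - drvK κ υ s) u) (slidHull (drvK κ υ) A s) with hΔ
  set mF : ℝ → ℝ := fun x ↦ MFnK κ A x.toNNReal υ with hmF
  -- finiteness on `[0, T]`
  have hFfin : ∀ x : ℝ, x ≤ T → F x < ∞ := fun x hx ↦ loopMass_hull_lt_top hW hA (halr x hx)
  -- the increment identity in the real variable
  have hincr : ∀ x y : ℝ, 0 ≤ x → x ≤ y → x ≤ T → F y = F x + Δ x.toNNReal (y - x).toNNReal := by
    intro x y hx hxy hxT
    have h := loopMass_hull_add_eq_of_conformalImage hX hW hAH (halr x hxT) (y - x).toNNReal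
    have hxy' : x.toNNReal + (y - x).toNNReal = y.toNNReal := by
      rw [← Real.toNNReal_add hx (sub_nonneg.2 hxy), add_sub_cancel]
    rw [hxy'] at h
    exact h
  have hfincr : ∀ x y : ℝ, 0 ≤ x → x ≤ y → y ≤ T →
      f y = f x + (Δ x.toNNReal (y - x).toNNReal).toReal := by
    intro x y hx hxy hyT
    have hxT : x ≤ T := hxy.trans hyT
    have hΔfin : Δ x.toNNReal (y - x).toNNReal < ∞ :=
      lt_of_le_of_lt (by rw [hincr x y hx hxy hxT]; exact le_add_self) (hFfin y hyT)
    simp only [hf]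
    rw [hincr x y hx hxy hxT, ENNReal.toReal_add (hFfin x hxT).ne hΔfin.ne]
  have hmono : ∀ x y : ℝ, 0 ≤ x → x ≤ y → y ≤ T → f x ≤ f y := by
    intro x y hx hxy hyT
    rw [hfincr x y hx hxy hyT]
    exact le_add_of_nonneg_right ENNReal.toReal_nonneg
  -- the uniform linear bound (Prop. 5.30, total mass) and the right derivative of the increments
  obtain ⟨C, δ, hδ, hbound⟩ := exists_loopMass_hull_incr_le h530a hW hA hne halive
  have hderivΔ : ∀ x : ℝ, x ≤ T →
      Tendsto (fun u : ℝ≥0 ↦ (Δ x.toNNReal u).toReal / (2 * (u : ℝ))) (𝓝[>] 0) (𝓝 (mF x)) := by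
    intro x hxT
    have hB : IsStarHull (slidHull (drvK κ υ) A x.toNNReal) :=
      Loewner.isStarHull_slidHull_of_disjoint hW hA (halr x hxT)
    have h := tendsto_loopMass_hull_incr_div h530b hW hB x.toNNReal
    have hm : mF x = starBubbleMass (slidHull (drvK κ υ) A x.toNNReal) := MFnK_of_alive (halr x hxT)
    rw [hm]
    exact h
  -- the Lipschitz-type bound and continuity of `f` on `[0, T]`
  have hlip : ∀ x y : ℝ, 0 ≤ x → x ≤ y → y ≤ T → y - x ≤ δ → f y - f x ≤ max C 0 * (y - x) := by
    intro x y hx hxy hyT hyx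
    rw [hfincr x y hx hxy hyT, add_sub_cancel_left]
    have hxT : x.toNNReal ≤ T := Real.toNNReal_le_iff_le_coe.2 (hxy.trans hyT)
    have h := hbound x.toNNReal hxT (y - x).toNNReal (by rw [Real.coe_toNNReal _ (sub_nonneg.2 hxy)]; exact hyx)
    have h2 := ENNReal.toReal_mono ENNReal.ofReal_ne_top h
    rw [Real.coe_toNNReal _ (sub_nonneg.2 hxy), ENNReal.toReal_ofReal'] at h2
    refine h2.trans (max_le ?_ ?_)
    · exact mul_le_mul_of_nonneg_right (le_max_left _ _) (sub_nonneg.2 hxy)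
    · exact mul_nonneg (le_max_right _ _) (sub_nonneg.2 hxy)
  have hfcont : ContinuousOn f (Icc 0 T) := by
    intro x hx
    rw [Metric.continuousWithinAt_iff]
    intro ε hε
    refine ⟨min δ (ε / (max C 0 + 1)), by positivity, fun y hy hyx ↦ ?_⟩
    rw [Real.dist_eq] at hyx ⊢
    have hyx1 : |y - x| < δ := lt_of_lt_of_le hyx (min_le_left _ _)
    have hyx2 : |y - x| < ε / (max C 0 + 1) := lt_of_lt_of_le hyx (min_le_right _ _)
    have key : |f y - f x| ≤ max C 0 * |y - x| := by
      rcases le_total x y with hxy | hxy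
      · rw [abs_of_nonneg (sub_nonneg.2 hxy)] at hyx1
        rw [abs_of_nonneg (sub_nonneg.2 (hmono x y hx.1 hxy hy.2)), abs_of_nonneg (sub_nonneg.2 hxy)]
        exact hlip x y hx.1 hxy hy.2 hyx1.le
      · rw [abs_sub_comm, abs_of_nonneg (sub_nonneg.2 hxy)] at hyx1
        rw [abs_sub_comm, abs_of_nonneg (sub_nonneg.2 (hmono y x hy.1 hxy hx.2)), abs_sub_comm,
          abs_of_nonneg (sub_nonneg.2 hxy)]
        exact hlip y x hy.1 hxy hx.2 hyx1.le
    have hC1 : 0 < max C 0 + 1 := by positivity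
    calc |f y - f x| ≤ max C 0 * |y - x| := key
      _ ≤ max C 0 * (ε / (max C 0 + 1)) := mul_le_mul_of_nonneg_left hyx2.le (le_max_right _ _)
      _ < ε := by
        rw [mul_div_assoc', div_lt_iff₀ hC1]
        nlinarith [le_max_right C 0]
  -- the right derivative of `f`
  have hfderiv : ∀ x ∈ Ico (0 : ℝ) T, HasDerivWithinAt f (2 * mF x) (Ici x) x := by
    intro x hx
    rw [hasDerivWithinAt_iff_tendsto_slope, Ici_sdiff_left]
    have hφ : Tendsto (fun y : ℝ ↦ (y - x).toNNReal) (𝓝[>] x) (𝓝[>] 0) := by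
      refine tendsto_nhdsWithin_of_tendsto_nhds_of_eventually_within _ ?_ ?_
      · have hc : Continuous fun y : ℝ ↦ (y - x).toNNReal := continuous_real_toNNReal.comp (continuous_id.sub continuous_const)
        simpa using (hc.tendsto x).mono_left nhdsWithin_le_nhds
      · filter_upwards [self_mem_nhdsWithin] with y hy
        show (0 : ℝ≥0) < (y - x).toNNReal
        exact Real.toNNReal_pos.2 (sub_pos.2 hy)
    have h2 := ((hderivΔ x hx.2.le).comp hφ).const_mul 2
    refine h2.congr' ?_
    filter_upwards [Ioo_mem_nhdsGT hx.2] with y hy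
    simp only [Function.comp_apply, slope_def_field]
    rw [hfincr x y hx.1 hy.1.le hy.2.le, add_sub_cancel_left, Real.coe_toNNReal _ (sub_nonneg.2 hy.1.le)]
    have hyx : y - x ≠ 0 := sub_ne_zero.2 hy.1.ne'
    field_simp
  -- the integrand: right-continuous, measurable, nonnegative, bounded on `[0, T]`
  have hmF_rc : ∀ y : ℝ, ContinuousWithinAt mF (Ici y) y := fun y ↦ by
    have h1 : ContinuousWithinAt (fun s : ℝ≥0 ↦ MFnK κ A s υ) (Ici y.toNNReal) y.toNNReal :=
      continuousWithinAt_MFnK hA hne υ _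
    exact h1.comp continuous_real_toNNReal.continuousWithinAt fun z hz ↦ Real.toNNReal_le_toNNReal hz
  have hmF_meas : Measurable mF :=
    (measurable_of_continuousWithinAt_Ici fun s ↦ continuousWithinAt_MFnK hA hne υ s).comp measurable_real_toNNReal
  have hmF_nn : ∀ y, 0 ≤ mF y := fun y ↦ MFnK_nonneg hA _ υ
  have hmF_le : ∀ y : ℝ, y ≤ T → mF y ≤ max C 0 / 2 := by
    intro y hyT
    refine le_of_tendsto (hderivΔ y hyT) ?_
    have hδ' : (0 : ℝ≥0) < ⟨δ, hδ.le⟩ := by exact_mod_cast hδ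
    filter_upwards [Ioc_mem_nhdsGT hδ'] with u hu
    have hu0 : (0 : ℝ) < u := by exact_mod_cast hu.1
    have hb := hbound y.toNNReal (Real.toNNReal_le_iff_le_coe.2 hyT) u (by exact_mod_cast hu.2)
    have h1 : (Δ y.toNNReal u).toReal ≤ max C 0 * u := by
      have h2 := ENNReal.toReal_mono ENNReal.ofReal_ne_top hb
      rw [ENNReal.toReal_ofReal'] at h2
      exact h2.trans (max_le (mul_le_mul_of_nonneg_right (le_max_left _ _) hu0.le)
        (mul_nonneg (le_max_right _ _) hu0.le))
    rw [div_le_iff₀ (by positivity)]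
    nlinarith
  have hint : ∀ x : ℝ, 0 ≤ x → x ≤ T → IntervalIntegrable mF volume 0 x := by
    intro x hx hxT
    rw [intervalIntegrable_iff_integrableOn_Ioc_of_le hx]
    refine Measure.integrableOn_of_bounded (M := max C 0 / 2) measure_Ioc_lt_top.ne hmF_meas.aestronglyMeasurable ?_
    filter_upwards [ae_restrict_mem measurableSet_Ioc] with y hy
    rw [Real.norm_eq_abs, abs_of_nonneg (hmF_nn y)]
    exact hmF_le y (hy.2.trans hxT)
  -- `g = 2 ∫₀ mF` and its right derivative
  set g : ℝ → ℝ := fun x ↦ 2 * ∫ y in (0 : ℝ)..x, mF y with hg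
  have hgderiv : ∀ x ∈ Ico (0 : ℝ) T, HasDerivWithinAt g (2 * mF x) (Ici x) x := by
    intro x hx
    have h := intervalIntegral.integral_hasDerivWithinAt_right (hint x hx.1 hx.2.le) (s := Ici x) (t := Ioi x)
      hmF_meas.stronglyMeasurable.stronglyMeasurableAtFilter ((hmF_rc x).mono Ioi_subset_Ici_self)
    exact h.const_mul 2
  have hgcont : ContinuousOn g (Icc 0 T) := by
    have hI : IntegrableOn mF (uIcc (0 : ℝ) T) volume := by
      rw [uIcc_of_le T.coe_nonneg]
      have := hint T T.coe_nonneg le_rfl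
      rwa [intervalIntegrable_iff_integrableOn_Icc_of_le T.coe_nonneg] at this
    have h := intervalIntegral.continuousOn_primitive_interval (μ := volume) hI
    rw [uIcc_of_le T.coe_nonneg] at h
    exact continuousOn_const.mul h
  -- both vanish at `0`
  have hf0 : f 0 = 0 := by
    simp only [hf, hF, Real.toNNReal_zero, hull_zero_holds hW, loopMass_empty_right, ENNReal.toReal_zero]
  have hg0 : g 0 = 0 := by simp [hg]
  -- conclusion in the real variable, then back to `ℝ≥0∞`
  have heq : f t = g t :=
    eq_of_has_deriv_right_eq hfderiv hgderiv hfcont hgcont (by rw [hf0, hg0]) t ⟨t.coe_nonneg, by exact_mod_cast ht⟩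
  have hFt : loopMass upperHalfPlaneSet A (hull (drvK κ υ) t) = ENNReal.ofReal (f t) := by
    have : F t = loopMass upperHalfPlaneSet A (hull (drvK κ υ) t) := by simp only [hF, Real.toNNReal_coe]
    rw [← this, hf]
    exact (ENNReal.ofReal_toReal (hFfin t (by exact_mod_cast ht)).ne).symm
  have hIt : IntegrableOn mF (Ioc (0 : ℝ) t) volume := by
    have := hint t t.coe_nonneg (by exact_mod_cast ht)
    rwa [intervalIntegrable_iff_integrableOn_Ioc_of_le t.coe_nonneg] at this
  rw [hFt, heq, hg, ENNReal.ofReal_mul zero_le_two, ENNReal.ofReal_ofNat,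
    intervalIntegral.integral_of_le t.coe_nonneg,
    ofReal_integral_eq_lintegral_ofReal hIt (ae_of_all _ fun y ↦ hmF_nn y)]

end Identity

end Literature.Probability.RandomPlanarGeometry

end
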